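import Summits.QuantumFields.QCD.Theorems.LightQuarkCompletion.Negative.Anatomy

/-!
# Crux `LightQuarkCompletion` (stmt-QuantumFields-18066, route NestedDissectionSea, rank 6), negative side, 3/3 —
# the pin clash: exactly how much "pin rigidity" the typed clauses carry

Support file of the standing disprover (cycle 2, refuter-cdisprove-stmt-QuantumFields-18066-g2-0, 2026-08-17; extract of
`Cruxes/LightQuarkCompletion/Disproof.lean` §8).  NO refutation of the crux.  Sorry-free, standard axioms; no definition;
nothing asserts a Theses decl.

The idea cards and the stubs of line `Sketch` (B2a `stub_jumpGerm`: "germs `J_k ∈ [−M₀, M₀]`"; B2b `stub_physicalBranch`: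
"a sharp two-sided jump can only sit at the physical line") argue with PIN RIGIDITY: two regularisations differing by an RGI
offset cannot both carry a two-sided parity pin.  Cycle 1 recorded that rigidity is NOT a theorem of the typed clauses as they
stand (the upper pin (b″) lives on odd tori of physical side in `[R, 2R]`, the lower pin (b) on sides `≥ R`, with `R` an
existential output chosen per package and tuple, so the two packages need not meet on a common torus).  This file proves the
EXACT positive statement and thereby isolates the missing datum:

* `pin_clash` — THE PIN CLASH.  A lower pin `PinClause Nf reg₁ M₀₁ m₁ R₁` and an upper pin `UpperPin Nf reg₂ M₀₂ m₂ R₂` over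
  regularisations with the same spacings and couplings, the same phase-quenched weights (bare sea trajectories coincide) and ONE
  common indicator bare mass (`m_crit₂ + a M₂/Z_m₂ = m_crit₁ − a M₁/Z_m₁` for some admissible `M₁ > M₀₁`, `M₂ > M₀₂`) are
  CONTRADICTORY as soon as the radii are COMPATIBLE, `R₁ < 2R₂`: on the fine grid of odd torus sides `a_k(2S+1)` (`a_k → 0`)
  there is a side in `[max R₁ R₂, 2R₂]` (`exists_odd_side_between`), where the same phase-quenched ratio would be `≥ 1/4` and
  `≤ 1/8`.
* Corollaries for re-centrings `upShift reg D` (`m_crit ↦ m_crit + a D/Z_m`) of ONE regularisation — the situation of the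
  line: `germ_not_below_of_compatible` (a zero-threshold UPPER pin of `upShift reg J` with `J < −M₀` clashes with the threshold
  LOWER pin of `reg`), `germ_not_above_of_compatible` (a zero-threshold LOWER pin of `upShift reg J` with `M₀ < J` clashes with
  the threshold UPPER pin of `reg`), `zeroGerm_unique_of_compatible` (two zero-threshold two-sided pins at germs `J₁ < J₂`
  clash) — EACH ONLY under the corresponding radius compatibility, which no hypothesis of the crux or of the stubs supplies.
* Moral for provers (B2a/B2b/(α)-type frame arguments): rigidity needs RADIUS BOOKKEEPING — either carry the radii explicitly
  and prove compatibility, or work with an upper pin valid on `[R, 2R]` for EVERY `R ≥ R₀` (physically expected: for fixed `R`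
  the early-crosser count on a torus of side `≤ 2R` vanishes as `k → ∞`), for which compatibility is automatic.  Citing
  "rigidity" without it is citing a non-theorem.
-/

noncomputable section

open scoped BigOperators Classical
open MeasureTheory Filter Topology Matrix
open Literature.MathematicalPhysics.QuantumLattice Literature.MathematicalPhysics.QuantumFieldTheory
  Literature.Probability.LatticeModels
open Summit.QuantumFields.QCD.Theses.NestedDissectionSea
open Summit.QuantumFields.QCD.Theorems.CoerciveSeaNegative
open Summit.QuantumFields.QCD.Theorems.EarlyCrosserLawNegative

namespace Summit.QuantumFields.QCD.Theorems.LightQuarkCompletion.Negative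

variable {Nf : ℕ}

/-! ## §8.1 A common torus -/

/-- **The grid of odd torus sides is fine.**  If the spacing `a > 0` satisfies `2a ≤ T − ρ` (`ρ > 0`), some odd torus side
`a(2S+1)` lies in `[ρ, T]`: take the least `S` with `ρ ≤ a(2S+1)`. [folklore] -/
theorem exists_odd_side_between {a ρ T : ℝ} (ha : 0 < a) (hρ : 0 < ρ) (hgap : 2 * a ≤ T - ρ) :
    ∃ S : ℕ, ρ ≤ a * (2 * (S : ℝ) + 1) ∧ a * (2 * (S : ℝ) + 1) ≤ T := by
  have hex : ∃ S : ℕ, ρ ≤ a * (2 * (S : ℝ) + 1) := by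
    obtain ⟨n, hn⟩ := exists_nat_ge (ρ / a)
    refine ⟨n, ?_⟩
    rw [div_le_iff₀ ha] at hn
    nlinarith
  refine ⟨Nat.find hex, Nat.find_spec hex, ?_⟩
  rcases Nat.eq_zero_or_pos (Nat.find hex) with h0 | hpos
  · rw [h0]
    push_cast
    linarith
  · obtain ⟨n, hn⟩ : ∃ n : ℕ, Nat.find hex = n + 1 := ⟨Nat.find hex - 1, by omega⟩
    have hmin : ¬ ρ ≤ a * (2 * (n : ℝ) + 1) := Nat.find_min hex (by omega)
    rw [hn]
    push_cast
    nlinarith [not_le.mp hmin]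

/-! ## §8.2 The pin clash -/

/-- **THE PIN CLASH.**  Let `reg₁, reg₂` have the same spacings and couplings, let the sea weights coincide
(`m_crit₂ + a m₂_f/Z_m₂ = m_crit₁ + a m₁_f/Z_m₁`), and let an admissible upper-pin mass of `reg₂` (height `M₂ > M₀₂`) coincide
with an admissible lower-pin mass of `reg₁` (depth `M₁ > M₀₁`).  Then the lower pin of `reg₁` (ratio `≥ 1/4` on every odd torus
of side `≥ R₁`, eventually) and the upper pin of `reg₂` (ratio `≤ 1/8` on odd tori of side in `[R₂, 2R₂]`, eventually) cannot
both hold if `R₁ < 2R₂`: eventually `2a_k ≤ 2R₂ − max R₁ R₂`, a common torus exists, and there the two clauses bound the SAME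
phase-quenched ratio.  WITHOUT `R₁ < 2R₂` nothing follows (the clauses never meet). [folklore] -/
theorem pin_clash {reg₁ reg₂ : QCDRegularisation Nf} {M₀₁ M₀₂ : ℝ} {m₁ m₂ : Fin Nf → ℝ} {R₁ R₂ : ℝ}
    (hlo : PinClause Nf reg₁ M₀₁ m₁ R₁) (hup : UpperPin Nf reg₂ M₀₂ m₂ R₂)
    (ha : ∀ k, reg₂.a k = reg₁.a k) (hβ : ∀ k, reg₂.β k = reg₁.β k)
    (hw : ∀ k f, reg₂.mcrit k + reg₂.a k * m₂ f / reg₂.Zm k = reg₁.mcrit k + reg₁.a k * m₁ f / reg₁.Zm k)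
    {M₁ M₂ : ℝ} (hM₁ : M₀₁ < M₁) (hM₂ : M₀₂ < M₂)
    (hμ : ∀ k, reg₂.mcrit k + reg₂.a k * M₂ / reg₂.Zm k = reg₁.mcrit k - reg₁.a k * M₁ / reg₁.Zm k)
    (hR₂ : 0 < R₂) (hR : R₁ < 2 * R₂) : False := by
  set ρ : ℝ := max R₁ R₂ with hρ
  have hρpos : 0 < ρ := lt_max_of_lt_right hR₂
  have hρlt : ρ < 2 * R₂ := max_lt hR (by linarith)
  -- eventually the grid is fine enough
  have hsmall : ∀ᶠ k : ℕ in atTop, 2 * reg₁.a k ≤ 2 * R₂ - ρ := by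
    have h2 : Tendsto (fun k => 2 * reg₁.a k) atTop (𝓝 0) := by simpa using reg₁.tendsto_a.const_mul 2
    exact h2.eventually (ge_mem_nhds (by linarith))
  obtain ⟨k, hk₁, hk₂, hk₃⟩ := ((hlo M₁ hM₁).and ((hup M₂ hM₂).and hsmall)).exists
  obtain ⟨S, hS₁, hS₂⟩ := exists_odd_side_between (reg₁.a_pos k) hρpos hk₃
  have hS₁' : R₁ ≤ reg₁.a k * (2 * (S : ℝ) + 1) := (le_max_left _ _).trans hS₁
  have hS₂' : R₂ ≤ reg₂.a k * (2 * (S : ℝ) + 1) := by rw [ha]; exact (le_max_right _ _).trans hS₁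
  have hS₃' : reg₂.a k * (2 * (S : ℝ) + 1) ≤ 2 * R₂ := by rw [ha]; exact hS₂
  have h1 := hk₁ S hS₁'
  have h2 := hk₂ S hS₂' hS₃'
  simp only [hw, hμ, hβ] at h2
  simp only at h1
  linarith

/-! ## §8.3 Consequences for re-centrings of one regularisation (the situation of line `Sketch`) -/

/-- **A germ strictly below `−M₀` is excluded — modulo radius compatibility.**  If `reg` carries the threshold LOWER pin at
the tuple `J + m'` with radius `R` and the re-centring `upShift reg J`, `J < −M₀`, carries a zero-threshold UPPER pin at the
positive tuple `m'` with radius `R'`, then `R < 2R'` is contradictory: depth `M := (M₀ − J)/2 > M₀` of `reg` and height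
`M' := (−M₀ − J)/2 > 0` of the re-centring are the same bare mass. [folklore] -/
theorem germ_not_below_of_compatible {reg : QCDRegularisation Nf} {M₀ J : ℝ} (hJ : J < -M₀) {m' : Fin Nf → ℝ} {R R' : ℝ}
    (hlo : PinClause Nf reg M₀ (fun f => J + m' f) R) (hup : UpperPin Nf (upShift reg J) 0 m' R') (hR' : 0 < R')
    (hRR' : R < 2 * R') : False := by
  refine pin_clash (M₁ := (M₀ - J) / 2) (M₂ := (-M₀ - J) / 2) hlo hup (fun k => rfl) (fun k => rfl)
    (fun k f => ?_) (by linarith) (by linarith) (fun k => ?_) hR' hRR'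
  · simp only [upShift_mcrit, upShift_a, upShift_Zm]
    ring
  · simp only [upShift_mcrit, upShift_a, upShift_Zm]
    ring

/-- **A germ strictly above `M₀` is excluded — modulo radius compatibility.**  If `reg` carries the threshold UPPER pin at the
tuple `J + m'` with radius `R` and the re-centring `upShift reg J`, `M₀ < J`, carries a zero-threshold LOWER pin at the positive
tuple `m'` with radius `R'`, then `R' < 2R` is contradictory: height `M := (J + M₀)/2 > M₀` of `reg` and depth
`M' := (J − M₀)/2 > 0` of the re-centring are the same bare mass. [folklore] -/
theorem germ_not_above_of_compatible {reg : QCDRegularisation Nf} {M₀ J : ℝ} (hJ : M₀ < J) {m' : Fin Nf → ℝ} {R R' : ℝ}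
    (hup : UpperPin Nf reg M₀ (fun f => J + m' f) R) (hlo : PinClause Nf (upShift reg J) 0 m' R') (hR : 0 < R)
    (hRR' : R' < 2 * R) : False := by
  refine pin_clash (M₁ := (J - M₀) / 2) (M₂ := (J + M₀) / 2) hlo hup (fun k => rfl) (fun k => rfl)
    (fun k f => ?_) (by linarith) (by linarith) (fun k => ?_) hR hRR'
  · simp only [upShift_mcrit, upShift_a, upShift_Zm]
    ring
  · simp only [upShift_mcrit, upShift_a, upShift_Zm]
    ring

/-- **The zero-threshold germ is unique — modulo radius compatibility.**  Two re-centrings `upShift reg J₁`, `upShift reg J₂`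
with `J₁ < J₂`, the higher one carrying a zero-threshold LOWER pin at the positive tuple `m₂` with radius `R₂` and the lower one a
zero-threshold UPPER pin at the tuple `m₁ = (J₂ − J₁) + m₂` with radius `R₁`, clash as soon as `R₂ < 2R₁`: depth and height
`(J₂ − J₁)/2 > 0` are the same bare mass. [folklore] -/
theorem zeroGerm_unique_of_compatible {reg : QCDRegularisation Nf} {J₁ J₂ : ℝ} (hJ : J₁ < J₂) {m₂ : Fin Nf → ℝ} {R₁ R₂ : ℝ}
    (hlo : PinClause Nf (upShift reg J₂) 0 m₂ R₂) (hup : UpperPin Nf (upShift reg J₁) 0 (fun f => (J₂ - J₁) + m₂ f) R₁)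
    (hR₁ : 0 < R₁) (hRR : R₂ < 2 * R₁) : False := by
  refine pin_clash (M₁ := (J₂ - J₁) / 2) (M₂ := (J₂ - J₁) / 2) hlo hup (fun k => rfl) (fun k => rfl)
    (fun k f => ?_) (by linarith) (by linarith) (fun k => ?_) hR₁ hRR
  · simp only [upShift_mcrit, upShift_a, upShift_Zm]
    ring
  · simp only [upShift_mcrit, upShift_a, upShift_Zm]
    ring

/-- **Inside ONE package the clash never fires**: the lower-pin masses `m_crit − a M/Z_m` (`M > M₀ ≥ 0`) and the upper-pin
masses `m_crit + a M'/Z_m` (`M' > M₀`) of the same regularisation are always distinct (indeed ordered), so a single two-sided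
pin package is consistent with respect to this mechanism whatever its radius; the clash is a statement about TWO pinning
coordinates. [folklore] -/
theorem lowerPinMass_lt_upperPinMass (reg : QCDRegularisation Nf) {M₀ M M' : ℝ} (hM₀ : 0 ≤ M₀) (hM : M₀ < M)
    (hM' : M₀ < M') (k : ℕ) :
    reg.mcrit k - reg.a k * M / reg.Zm k < reg.mcrit k + reg.a k * M' / reg.Zm k := by
  have ha := reg.a_pos k
  have hZ := reg.Zm_pos k
  have h1 : 0 < reg.a k * M / reg.Zm k := by
    apply div_pos (mul_pos ha (by linarith)) hZ
  have h2 : 0 < reg.a k * M' / reg.Zm k := by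
    apply div_pos (mul_pos ha (by linarith)) hZ
  linarith

/-! ## §8.4 With an upper pin quantified over ALL radii, rigidity becomes unconditional

The physically expected form of the upper pin is "for EVERY radius `R ≥ R₀` (and every height `M > M₀`), eventually in `k`, on
odd tori of side in `[R, 2R]` the ratio is `≤ 1/8`" (`k` after `R`: at fixed `R` the early-crosser count on tori of side `≤ 2R`
vanishes as `k → ∞`).  Under that form the radius compatibility of §8.3 is AUTOMATIC (take `R := max R₀ R_lower`), so the germ
confinement and uniqueness statements hold outright.  This is the precise sense in which the crux's `∃ R` (one radius shared by
the lower and the upper pin of a package) is what keeps rigidity from being a theorem. -/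

/-- **Germ below `−M₀` excluded outright when the re-centring's upper pin holds at all radii `≥ R₀`.** [folklore] -/
theorem germ_not_below_of_allRadii {reg : QCDRegularisation Nf} {M₀ J : ℝ} (hJ : J < -M₀) {m' : Fin Nf → ℝ} {R R₀ : ℝ}
    (hlo : PinClause Nf reg M₀ (fun f => J + m' f) R) (hR₀ : 0 < R₀)
    (hup : ∀ R', R₀ ≤ R' → UpperPin Nf (upShift reg J) 0 m' R') : False :=
  germ_not_below_of_compatible hJ hlo (hup (max R₀ R) (le_max_left _ _)) (lt_max_of_lt_left hR₀)
    (by have := le_max_right R₀ R; have := le_max_left R₀ R; linarith)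

/-- **Germ above `M₀` excluded outright when the threshold upper pin of `reg` holds at all radii `≥ R₀`.** [folklore] -/
theorem germ_not_above_of_allRadii {reg : QCDRegularisation Nf} {M₀ J : ℝ} (hJ : M₀ < J) {m' : Fin Nf → ℝ} {R' R₀ : ℝ}
    (hup : ∀ R, R₀ ≤ R → UpperPin Nf reg M₀ (fun f => J + m' f) R) (hlo : PinClause Nf (upShift reg J) 0 m' R')
    (hR₀ : 0 < R₀) : False :=
  germ_not_above_of_compatible hJ (hup (max R₀ R') (le_max_left _ _)) hlo (lt_max_of_lt_left hR₀)
    (by have := le_max_right R₀ R'; have := le_max_left R₀ R'; linarith)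

/-- **Zero-threshold germ unique outright when upper pins hold at all radii `≥ R₀`.** [folklore] -/
theorem zeroGerm_unique_of_allRadii {reg : QCDRegularisation Nf} {J₁ J₂ : ℝ} (hJ : J₁ < J₂) {m₂ : Fin Nf → ℝ} {R₂ R₀ : ℝ}
    (hlo : PinClause Nf (upShift reg J₂) 0 m₂ R₂) (hR₀ : 0 < R₀)
    (hup : ∀ R₁, R₀ ≤ R₁ → UpperPin Nf (upShift reg J₁) 0 (fun f => (J₂ - J₁) + m₂ f) R₁) : False :=
  zeroGerm_unique_of_compatible hJ hlo (hup (max R₀ R₂) (le_max_left _ _)) (lt_max_of_lt_left hR₀)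
    (by have := le_max_right R₀ R₂; have := le_max_left R₀ R₂; linarith)

end Summit.QuantumFields.QCD.Theorems.LightQuarkCompletion.Negative

end
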